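import Summits.BirchSwinnertonDyer.Rank1Residual.Supersingular.X6VisibilityTamDefectL1CertLocTorRecords
import Summits.BirchSwinnertonDyer.Rank1Residual.Supersingular.X6RankZeroLeafTarget
import HarnessLib

/-!
# Leaf `ClassX6 ∧ r_an = 0` (A6): the route-`PrintX6` witness cell `(22678e1, p = 5)` WITHOUT KATO'S BOUND — the typed LOWER half
# `MissingLowerBoundAt W 5` (and E₅'s conclusion at the cell) from Cremona–Mazur visibility + Cassels–Tate alone, in a module
# OUTSIDE the route file's importers (cell `bsd-print-x6`, seat p4 gen 1; PLAN v2 task (W), «hW-free variant (better)»)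

PARTITION currency (D-0054): leaf A6 = X6 ∧ r_an = 0; ONE cell; nothing booked here (the cell is PROVED-by-name of record since
referee A R318); BEYOND-PRINT THEOREM: **NO**. Companion of `X6RankZeroWitness22678e1.lean` (p542927:
`X6RankZero.eisensteinHalfFiveLe_cell_22678e1_at5`, which reads E₅'s conclusion at the cell off the landed visibility CLOSURE
`bsdp_x6r0visblt_22678e1_5` and therefore carries Wuthrich 2014 Prop. 21 `hW` and modularity `hmod` — the UPPER half — among
its binders although the statement is a LOWER bound).

WHAT THIS FILE DOES. It threads the visibility chain of b2b-bsdres (unit x10b gens 22–24: `X6VisibilityTamDefectShape` →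
`X6VisibilityTamDefectRecords` → `…L1CertRecords` → `…L1CertLocRecords` → `…L1CertLocTorRecords`) once more, STOPPING AT THE
LOWER HALF: (1) `X6RankZero.missingLowerBoundAt_of_casselsTate_of_congr_of_places₄` = the Shape theorem
`X6RankZero.bsdp_of_casselsTate_of_congr_of_places₄` minus its last line (no `hW`, no `hmod`): a `p`-congruence `θ : E'[p] ≅ E[p]`,
a partner `E'` of rank `r'` and Cremona–Mazur / Fisher local conditions at a finite set of places ⟹ `Ш(E)[p] ≠ 0`
(`exists_sha_ne_zero_of_congr_of_places₄_rat`) ⟹ `p ∣ #Ш` ⟹ with Cassels–Tate and `ord_p #Ш_an ≤ 2`, `MissingLowerBoundAt W p`;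
(2) `X6RankZero.missingLowerBoundAt_x6r0vis_22678e1_5_of_congr` = `bsdp_x6r0vis_22678e1_5_of_congr` minus Wuthrich (the
place bookkeeping S = {2,5,17,19,23,29}, T = {5}, kinds (i)/(iii)/(iv), VERBATIM); (3) `X6RankZero.missingLowerBoundAt_cell_22678e1_at5`
and `X6RankZero.eisensteinHalfFiveLe_cell_22678e1_at5'`: every displayed datum discharged exactly as in the landed layers — the
`5`-congruence by Fisher's Hesse certificate (`fiveCongruent_of_hesseCertificate`, λ = −641807), `r_an = 0` and `ord₅ #Ш_an ≤ 2` by the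
engine's level-one ENCLOSURE `hball0` (`analyticRank_shaAn_of_LOneBall_of_rowCheckZ`), the partner's rank by `two_le_rank_c430882i1`,
kind (iii) at 2, 29 by the square-class decider, kinds (i) at 5, 17, 23 by the odd local torsion decider — so that the binders are
EXACTLY {Cassels–Tate `hCT`, GZK `hGZK`, period comparison `hϖ`, Tate uniformisation `hU`/`hU2`, Fisher Thm 4.4 `hF44`, Fisher Thm 13.2
`hF13`, the two models, the newform `f`/`hf`, `hball0`}: NO Wuthrich Prop. 21, NO modularity-as-entire-L binder, NO Kato-side input
at all. With the route's own upper half (`UpperHalfX6`, PROVED from `PublishedInputsX6`) this closes the cell on the route's trust base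
(compose with `PrintX6.X6.bsdp_rankZero_of_publishedInputsX6_of_missingLowerBoundAt`, a `Theorems/PrintX6*` file may do so; this
module must not import the route).

Nothing is recomputed: every `decide +kernel` certificate below is the one of the landed layer it is copied from. References:
[CremonaMazur2000] §3; [Fisher2016Visualizing7] Thm 4.4; [Fisher2012Hessian] Thm 13.2; [SilvermanATAEC1994] V.5.3/5.4;
[SilvermanAEC2009] X.4.14; [Miller2011LMS] Def 1.1; HOME/PLAN.md v2 (W).
-/

set_option autoImplicit false

noncomputable section

open scoped Classical MatrixGroups ModularForm

open CongruenceSubgroup WeierstrassCurve Literature.NumberTheory.EllipticCurves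
  Literature.NumberTheory.EllipticCurves.Rank1Residual
  Literature.NumberTheory.EllipticCurves.Rank1Residual.Typed
  Literature.NumberTheory.EllipticCurves.Rank1Residual.X11RankOneCertificates
  Literature.NumberTheory.EllipticCurves.Wuthrich2014
  Literature.NumberTheory.EllipticCurves.Fisher2016
  Literature.NumberTheory.EllipticCurves.Fisher2012
  Summit.BirchSwinnertonDyer.BirchSwinnertonDyer.Rank1Residual.IntModel
  Summit.BirchSwinnertonDyer.Rank1Residual.X11b
  Literature.NumberTheory.EllipticCurves.ModularForms
  Summit.BirchSwinnertonDyer.BirchSwinnertonDyer.Rank2Observatory.Tam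
open NumberField IsDedekindDomain Rat.HeightOneSpectrum
open Summit.BirchSwinnertonDyer.Rank1Residual.Supersingular.LocalOddTorsion
open Summit.BirchSwinnertonDyer.Rank1Residual.GaloisImage.LocalTorsion3At (exists_eq_sq_mul_of_sqFlagAt)

namespace Summit.BirchSwinnertonDyer.Rank1Residual.Supersingular

/-! ### §1 The visibility SHAPE, stopped at the lower half (no Kato-side input) -/

/-- **X6 ∩ {r_an = 0}, odd `p`, `ord_p #Ш_an ≤ 2`: the typed LOWER half `MissingLowerBoundAt W p` from a `p`-CONGRUENCE with a
curve of large rank + the Cremona–Mazur / Fisher local conditions + Cassels–Tate — NO upper-bound input.** Exactly the hypotheses of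
`X6RankZero.bsdp_of_casselsTate_of_congr_of_places₄` (the landed Shape theorem) minus Wuthrich 2014 Prop. 21 and modularity, and its
proof minus the last line: `E(ℚ)` finite of order prime to `p` (GZK at `r_an = 0`, `ClassX6.irr`), so the visible subgroup gives
`Ш(E)[p] ≠ 0` (`exists_sha_ne_zero_of_congr_of_places₄_rat`: Tate uniformisation `hU`/`hU2`, Fisher Thm 4.4 `hF44`, the place data
`hS`/`hT`/`hplaces`), hence `p ∣ #Ш(E/ℚ)`, and Cassels–Tate squareness with `ord_p #Ш_an ≤ 2` gives `ord_p #Ш_an ≤ ord_p #Ш`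
(`missingLowerBoundAt_of_casselsTate_of_pow_dvd`). Per pair; not a class theorem. [cite: CremonaMazur2000, §3 and Table 1]
[cite: Fisher2016Visualizing7, Thm. 4.4 (p. 106)] [cite: SilvermanATAEC1994, Ch. V Thm. 5.3, Cor. 5.4] [cite: SilvermanAEC2009, Thm. X.4.14]
[cite: Miller2011LMS, Def. 1.1] -/
theorem X6RankZero.missingLowerBoundAt_of_casselsTate_of_congr_of_places₄
    (hCT : exists_casselsTate_pairing (K := ℚ))
    (hGZK : rank_eq_analyticRank_of_analyticRank_le_one)
    (hU : Silverman1994_thmV53_tateUniformisation.{0})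
    (hU2 : Silverman1994_thmV53_corV54_tateUniformisation.{0})
    (hF44 : thm44_selmerLocalKer_iff_of_nonsplit_good)
    (W : WeierstrassCurve ℚ) [W.IsElliptic] [W.IsGloballyMinimal] (p : ℕ) [Fact p.Prime] (hp : p ≠ 2)
    (hX : ClassX6 W p) (hr : W.analyticRank = 0) {q : ℚ} (hq : shaAn W = (q : ℂ)) (hv : padicValRat p q ≤ 2)
    (W' : WeierstrassCurve ℚ) [W'.IsElliptic]
    (θ : geomTorsion W' (p : ℤ) ≃+ geomTorsion W (p : ℤ))
    (hθ : ∀ (σ : Field.absoluteGaloisGroup ℚ) (P : geomTorsion W' (p : ℤ)), θ (σ • P) = σ • θ P)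
    (S T : Finset (HeightOneSpectrum (𝓞 ℚ))) (hTS : T ⊆ S)
    (hS : ∀ w : HeightOneSpectrum (𝓞 ℚ), w ∉ S →
      W.HasGoodReductionAt w ∧ W'.HasGoodReductionAt w ∧ (p : 𝓞 ℚ) ∉ w.asIdeal)
    (hT : (∏ w ∈ T, Nat.card (nsmulAddMonoidHom p :
        (W'.baseChange (w.adicCompletion ℚ)).toAffine.Point →+ _).ker *
        Nat.card (w.adicCompletionIntegers ℚ ⧸
          Ideal.span {(p : w.adicCompletionIntegers ℚ)})) < p ^ W'.mordellWeilRank)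
    (hplaces : ∀ w ∈ S, w ∉ T →
      ((p : 𝓞 ℚ) ∉ w.asIdeal ∧ Nat.card (nsmulAddMonoidHom p :
          (W'.baseChange (w.adicCompletion ℚ)).toAffine.Point →+ _).ker = 1) ∨
      (W.HasSplitMultiplicativeReductionAt w ∧ W'.HasSplitMultiplicativeReductionAt w ∧
        Nat.card (nsmulAddMonoidHom p :
          (W.baseChange (w.adicCompletion ℚ)).toAffine.Point →+ _).ker ≤ p) ∨
      (W.HasMultiplicativeReductionAt w ∧ W'.HasMultiplicativeReductionAt w ∧
        (∃ r : w.adicCompletion ℚ, algebraMap ℚ (w.adicCompletion ℚ) (-(W.c₄ / W.c₆)) =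
          r ^ 2 * algebraMap ℚ (w.adicCompletion ℚ) (-(W'.c₄ / W'.c₆))) ∧
        (∀ ζ : w.adicCompletion ℚ, ζ ^ p = 1 → ζ = 1)) ∨
      ((W.HasMultiplicativeReductionAt w ∧ ¬ W.HasSplitMultiplicativeReductionAt w ∧
          W'.HasGoodReductionAt w) ∨
        (W.HasGoodReductionAt w ∧ W'.HasMultiplicativeReductionAt w ∧
          ¬ W'.HasSplitMultiplicativeReductionAt w))) :
    MissingLowerBoundAt W p := by
  haveI hfin : Finite W.toAffine.Point := finite_point_of_analyticRank_eq_zero W hGZK hr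
  have hirr : Irr W p := ClassX6.irr W p hp hX
  have hcop : (Nat.card W.toAffine.Point).Coprime p := coprime_natCard_point_of_irr W p hirr
  have hex : ∃ c : W.sha, c ≠ 0 ∧ p • c = 0 :=
    W.exists_sha_ne_zero_of_congr_of_places₄_rat hU hU2 hF44 hp W' θ hθ S T hTS hS hfin hcop hT hplaces
  have hfinSha : W.ShaFinite := (hGZK W (by rw [hr]; norm_num)).2
  exact missingLowerBoundAt_of_casselsTate_of_pow_dvd W p hCT hfinSha hq (k := 1) (by simpa using hv)
    (by simpa using dvd_shaOrder_of_exists_torsion W p hex)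

/-! ### §2 The cell `(22678e1, 5)`: the place bookkeeping of `bsdp_x6r0vis_22678e1_5_of_congr`, verbatim, ending at the lower half -/

/-- **`22678e1` @ `5`: `MissingLowerBoundAt W 5` from the `5`-congruence with the rank-2 partner `430882i1` (displayed `θ`), the
partner's rank, the local data at `S = {2, 5, 17, 19, 23, 29}` (paid place `T = {5}`: `5·#F(ℚ₅)[5] = 5 < 25 ≤ 5^{rank F}`; kind (i) at
17, 23; kind (iii) at 2, 29; kind (iv) at 19 decided in the kernel from the integer models), the Cremona-type data `r_an = 0`,
`#Ш_an = q`, `ord₅ q ≤ 2`, and Cassels–Tate — NO Wuthrich, NO modularity binder.** The body is that of the landed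
`bsdp_x6r0vis_22678e1_5_of_congr` (x10b gen 22) with the Shape theorem replaced by its lower-half twin of §1.
[cite: CremonaMazur2000, §3 and Table 1] [cite: Fisher2016Visualizing7, Thm. 4.4 (p. 106)]
[cite: SilvermanATAEC1994, Ch. V Thm. 3.1, Lemma 5.2, Thm. 5.3, Cor. 5.4] [cite: SilvermanAEC2009, VII.5 Prop. 5.1 and Thm. X.4.14]
[cite: Cremona2006, Table 1 (Cremona labels 22678e1, 430882i1)] -/
theorem X6RankZero.missingLowerBoundAt_x6r0vis_22678e1_5_of_congr
    (hCT : exists_casselsTate_pairing (K := ℚ))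
    (hGZK : rank_eq_analyticRank_of_analyticRank_le_one)
    (hU : Silverman1994_thmV53_tateUniformisation.{0})
    (hU2 : Silverman1994_thmV53_corV54_tateUniformisation.{0})
    (hF44 : thm44_selmerLocalKer_iff_of_nonsplit_good)
    {W F : WeierstrassCurve ℚ} [W.IsElliptic] [W.IsGloballyMinimal] [F.IsElliptic] [F.IsGloballyMinimal]
    (hWeq : W = ⟨1, 0, 0, 3140254662, -139987982322460⟩) (hFeq : F = ⟨1, 0, 0, -14128, -645920⟩)
    -- Cremona data of the target
    (hr0 : W.analyticRank = 0) {q : ℚ} (hq : shaAn W = (q : ℂ)) (hv : padicValRat 5 q ≤ 2)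
    -- the 5-congruence (displayed binder in this form; the Hesse-certificate form below DISCHARGES it)
    (θ : geomTorsion F (5 : ℤ) ≃+ geomTorsion W (5 : ℤ))
    (hθ : ∀ (σ : Field.absoluteGaloisGroup ℚ) (P : geomTorsion F (5 : ℤ)), θ (σ • P) = σ • θ P)
    -- the partner's rank
    (hrank : 2 ≤ F.mordellWeilRank)
    -- local data of the partner / the pair (displayed binders)
    (h5 : ∀ w : HeightOneSpectrum (𝓞 ℚ), (primesEquiv w : ℕ) = 5 →
      Nat.card (nsmulAddMonoidHom 5 : (F.baseChange (w.adicCompletion ℚ)).toAffine.Point →+ _).ker = 1)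
    (h17 : ∀ w : HeightOneSpectrum (𝓞 ℚ), (primesEquiv w : ℕ) = 17 →
      Nat.card (nsmulAddMonoidHom 5 : (F.baseChange (w.adicCompletion ℚ)).toAffine.Point →+ _).ker = 1)
    (h23 : ∀ w : HeightOneSpectrum (𝓞 ℚ), (primesEquiv w : ℕ) = 23 →
      Nat.card (nsmulAddMonoidHom 5 : (F.baseChange (w.adicCompletion ℚ)).toAffine.Point →+ _).ker = 1)
    (h2 : ∀ w : HeightOneSpectrum (𝓞 ℚ), (primesEquiv w : ℕ) = 2 →
      (∃ r : w.adicCompletion ℚ, algebraMap ℚ (w.adicCompletion ℚ) (-(W.c₄ / W.c₆)) =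
          r ^ 2 * algebraMap ℚ (w.adicCompletion ℚ) (-(F.c₄ / F.c₆))) ∧
        (∀ ζ : w.adicCompletion ℚ, ζ ^ 5 = 1 → ζ = 1))
    (h29 : ∀ w : HeightOneSpectrum (𝓞 ℚ), (primesEquiv w : ℕ) = 29 →
      (∃ r : w.adicCompletion ℚ, algebraMap ℚ (w.adicCompletion ℚ) (-(W.c₄ / W.c₆)) =
          r ^ 2 * algebraMap ℚ (w.adicCompletion ℚ) (-(F.c₄ / F.c₆))) ∧
        (∀ ζ : w.adicCompletion ℚ, ζ ^ 5 = 1 → ζ = 1)) :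
    MissingLowerBoundAt W 5 := by
  haveI : Fact (Nat.Prime 5) := ⟨by norm_num⟩
  haveI : Fact (Nat.Prime 19) := ⟨by norm_num⟩
  have hIW : integralModelInt W = ⟨1, 0, 0, 3140254662, -139987982322460⟩ :=
    integralModelInt_eq_of_map_eq _ (by rw [hWeq]; ext <;> simp [WeierstrassCurve.map])
  have hIF : integralModelInt F = ⟨1, 0, 0, -14128, -645920⟩ :=
    integralModelInt_eq_of_map_eq _ (by rw [hFeq]; ext <;> simp [WeierstrassCurve.map])
  -- class X6 at 5 for the target
  have hX : ClassX6 W 5 :=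
    classX6_of_intModel 5 le_rfl hIW (by decide +kernel) card_c22678e1_5 (by decide) (by decide +kernel)
  -- the prime lists: every prime divisor of Δ_E, Δ_F lies in L
  set L : List ℕ := [2, 5, 17, 19, 23, 29] with hL
  have hLp : ∀ q ∈ L, q.Prime := by decide
  have hΔE : ∀ q : ℕ, q.Prime → (q : ℤ) ∣ (⟨1, 0, 0, 3140254662, -139987982322460⟩ : WeierstrassCurve ℤ).Δ →
      q ∈ L :=
    forall_mem_of_natAbs_eq_prod_pow L [75, 0, 1, 0, 1, 4] hLp (by decide +kernel)
  have hΔF : ∀ q : ℕ, q.Prime → (q : ℤ) ∣ (⟨1, 0, 0, -14128, -645920⟩ : WeierstrassCurve ℤ).Δ → q ∈ L :=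
    forall_mem_of_natAbs_eq_prod_pow L [5, 0, 1, 5, 1, 1] hLp (by decide +kernel)
  -- the sets of places S (over L) and T (over 5)
  set e := primesEquiv (R := 𝓞 ℚ) with he
  set v₅ : HeightOneSpectrum (𝓞 ℚ) := e.symm ⟨5, Fact.out⟩ with hv₅def
  have hv₅ : (e v₅ : ℕ) = 5 := by rw [hv₅def, Equiv.apply_symm_apply]
  have heq5 : ∀ w : HeightOneSpectrum (𝓞 ℚ), (e w : ℕ) = 5 → w = v₅ := by
    intro w hw
    have h1 : e w = ⟨5, Fact.out⟩ := Subtype.ext hw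
    rw [hv₅def, ← h1, Equiv.symm_apply_apply]
  set S : Finset (HeightOneSpectrum (𝓞 ℚ)) :=
    (L.filterMap fun r ↦ if h : r.Prime then some (e.symm ⟨r, h⟩) else none).toFinset with hSdef
  have hmemS : ∀ w : HeightOneSpectrum (𝓞 ℚ), w ∈ S ↔ (e w : ℕ) ∈ L := by
    intro w
    rw [hSdef, List.mem_toFinset, List.mem_filterMap]
    constructor
    · rintro ⟨r, hr, hrw⟩
      by_cases hrp : r.Prime
      · rw [dif_pos hrp, Option.some.injEq] at hrw
        rw [← hrw, Equiv.apply_symm_apply]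
        exact hr
      · rw [dif_neg hrp] at hrw
        exact absurd hrw (by simp)
    · intro hw
      refine ⟨(e w : ℕ), hw, ?_⟩
      rw [dif_pos (e w).2]
      simp
  set T : Finset (HeightOneSpectrum (𝓞 ℚ)) := {v₅} with hTdef
  have hTS : T ⊆ S := by
    intro w hw
    rw [hTdef, Finset.mem_singleton] at hw
    rw [hmemS, hw, hv₅]; decide
  -- good reduction outside S
  have hS : ∀ w : HeightOneSpectrum (𝓞 ℚ), w ∉ S →
      W.HasGoodReductionAt w ∧ F.HasGoodReductionAt w ∧ ((5 : ℕ) : 𝓞 ℚ) ∉ w.asIdeal := by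
    intro w hwS
    have hwL : (e w : ℕ) ∉ L := fun h ↦ hwS ((hmemS w).mpr h)
    have hq : (e w : ℕ).Prime := (e w).2
    refine ⟨?_, ?_, natCast_not_mem_of_primesEquiv_ne w Fact.out fun h ↦ hwL ?_⟩
    · rw [hWeq]; exact hasGoodReductionAt_mk_of_primesEquiv _ _ _ _ _ w rfl fun h ↦ hwL (hΔE _ hq h)
    · rw [hFeq]; exact hasGoodReductionAt_mk_of_primesEquiv _ _ _ _ _ w rfl fun h ↦ hwL (hΔF _ hq h)
    · show (primesEquiv w : ℕ) ∈ L
      rw [h]; decide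
  -- the paid place 5: `#F(ℚ₅)[5] · #(ℤ₅/5) = 1 · 5 < 25 ≤ 5 ^ rank F`
  have hcard5 : ∏ w ∈ T, Nat.card (w.adicCompletionIntegers ℚ ⧸
      Ideal.span {((5 : ℕ) : w.adicCompletionIntegers ℚ)}) = 5 ^ Module.finrank ℚ ℚ :=
    WeierstrassCurve.prod_natCard_quot_adicCompletionIntegers (K := ℚ) (p := 5) T fun w hw h ↦
      hw (by rw [hTdef, Finset.mem_singleton]; exact heq5 w (primesEquiv_eq_of_natCast_mem Fact.out h))
  have hT : (∏ w ∈ T, Nat.card (nsmulAddMonoidHom 5 :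
        (F.baseChange (w.adicCompletion ℚ)).toAffine.Point →+ _).ker *
        Nat.card (w.adicCompletionIntegers ℚ ⧸
          Ideal.span {((5 : ℕ) : w.adicCompletionIntegers ℚ)})) < 5 ^ F.mordellWeilRank := by
    rw [Finset.prod_mul_distrib, hcard5, Module.finrank_self, hTdef, Finset.prod_singleton, h5 v₅ hv₅]
    calc (1 : ℕ) * 5 ^ 1 < 5 ^ 2 := by norm_num
      _ ≤ 5 ^ F.mordellWeilRank := Nat.pow_le_pow_right (by norm_num) hrank
  -- the free places
  have hplaces : ∀ w ∈ S, w ∉ T →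
      (((5 : ℕ) : 𝓞 ℚ) ∉ w.asIdeal ∧ Nat.card (nsmulAddMonoidHom 5 :
          (F.baseChange (w.adicCompletion ℚ)).toAffine.Point →+ _).ker = 1) ∨
      (W.HasSplitMultiplicativeReductionAt w ∧ F.HasSplitMultiplicativeReductionAt w ∧
        Nat.card (nsmulAddMonoidHom 5 :
          (W.baseChange (w.adicCompletion ℚ)).toAffine.Point →+ _).ker ≤ 5) ∨
      (W.HasMultiplicativeReductionAt w ∧ F.HasMultiplicativeReductionAt w ∧
        (∃ r : w.adicCompletion ℚ, algebraMap ℚ (w.adicCompletion ℚ) (-(W.c₄ / W.c₆)) =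
          r ^ 2 * algebraMap ℚ (w.adicCompletion ℚ) (-(F.c₄ / F.c₆))) ∧
        (∀ ζ : w.adicCompletion ℚ, ζ ^ 5 = 1 → ζ = 1)) ∨
      ((W.HasMultiplicativeReductionAt w ∧ ¬ W.HasSplitMultiplicativeReductionAt w ∧
          F.HasGoodReductionAt w) ∨
        (W.HasGoodReductionAt w ∧ F.HasMultiplicativeReductionAt w ∧
          ¬ F.HasSplitMultiplicativeReductionAt w)) := by
    intro w hwS hwT
    have hwL : (e w : ℕ) ∈ L := (hmemS w).mp hwS
    have hw5 : (e w : ℕ) ≠ 5 := fun h ↦ hwT (by rw [hTdef, Finset.mem_singleton]; exact heq5 w h)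
    have hcases : (e w : ℕ) = 2 ∨ (e w : ℕ) = 17 ∨ (e w : ℕ) = 19 ∨ (e w : ℕ) = 23 ∨ (e w : ℕ) = 29 := by
      simp only [hL, List.mem_cons, List.mem_nil_iff, or_false] at hwL
      omega
    rcases hcases with hw | hw | hw | hw | hw
    · -- 2: both multiplicative (kernel), same γ-class and μ₅(ℚ₂) = 1 (binders)
      exact Or.inr (Or.inr (Or.inl ⟨hasMultiplicativeReductionAt_of_intModel_of_primesEquiv hIW w hw
        (by decide +kernel) (by decide +kernel), hasMultiplicativeReductionAt_of_intModel_of_primesEquiv hIF w hw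
        (by decide +kernel) (by decide +kernel), h2 w hw⟩))
    · -- 17: kind (i)
      exact Or.inl ⟨natCast_not_mem_of_primesEquiv_ne w Fact.out hw5, h17 w hw⟩
    · -- 19: kind (iv): E good, F non-split multiplicative (all kernel)
      refine Or.inr (Or.inr (Or.inr (Or.inr ⟨?_, ?_, ?_⟩)))
      · rw [hWeq]; exact hasGoodReductionAt_mk_of_primesEquiv _ _ _ _ _ w hw (by decide +kernel)
      · exact hasMultiplicativeReductionAt_of_intModel_of_primesEquiv hIF w hw (by decide +kernel)
          (by decide +kernel)
      · exact not_hasSplitMultiplicativeReductionAt_of_intModel_of_noroot hIF w hw (by decide +kernel)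
          (by decide +kernel) noroot_c430882i1_19
    · -- 23: kind (i)
      exact Or.inl ⟨natCast_not_mem_of_primesEquiv_ne w Fact.out hw5, h23 w hw⟩
    · -- 29: both multiplicative (kernel), same γ-class and μ₅(ℚ₂₉) = 1 (binders)
      exact Or.inr (Or.inr (Or.inl ⟨hasMultiplicativeReductionAt_of_intModel_of_primesEquiv hIW w hw
        (by decide +kernel) (by decide +kernel), hasMultiplicativeReductionAt_of_intModel_of_primesEquiv hIF w hw
        (by decide +kernel) (by decide +kernel), h29 w hw⟩))
  exact X6RankZero.missingLowerBoundAt_of_casselsTate_of_congr_of_places₄ hCT hGZK hU hU2 hF44 W 5 (by norm_num) hX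
    hr0 hq hv F θ hθ S T hTS hS hT hplaces

/-! ### §3 Every displayed datum discharged: the hW-free witness -/

/-- **`22678e1` @ `5`: the typed LOWER half `MissingLowerBoundAt W 5` with EVERY displayed datum discharged in the kernel and NO
Kato-side binder.** Binders: Cassels–Tate `hCT`, GZK `hGZK`, the period comparison `hϖ` (for reading `#Ш_an` off the enclosure),
Tate uniformisation `hU`/`hU2`, Fisher Thm 4.4 `hF44`, Fisher Thm 13.2 `hF13` (Hesse pencil ⟹ the `5`-congruence, certificate
λ = −641807, u = 207777213817353652567632204791808 re-verified by `norm_num`), the two minimal models, the newform `f`/`hf` of `E`, and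
the engine's level-one enclosure `hball0` of `3·L(E,1)/ω₁ = 1250` (kit j202394 / j256108) — which yields `r_an = 0`, `#Ш_an = q`,
`ord₅ q ≤ 2` (`analyticRank_shaAn_of_LOneBall_of_rowCheckZ`, Tamagawa/torsion rows checked by `decide`). Local data: kind (iii) at
2 and 29 (`exists_eq_sq_mul_of_sqFlagAt`, `adicCompletion_pow_eq_one_imp`), kind (i) at 5, 17, 23
(`natCard_ker_nsmul_five_adicCompletion_eq_one_of_checkAt`), all with the certificates of the landed layers, verbatim.
[cite: Fisher2012Hessian, Thm. 13.2] [cite: Fisher2016Visualizing7, Thm. 4.4 (p. 106)] [cite: CremonaMazur2000, §3]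
[cite: SilvermanAEC2009, Thm. X.4.14] [cite: GreenbergVatsal2000, §3 Rem. 3.4] [cite: Miller2011LMS, Def. 1.1] -/
theorem X6RankZero.missingLowerBoundAt_cell_22678e1_at5
    (hCT : exists_casselsTate_pairing (K := ℚ))
    (hGZK : rank_eq_analyticRank_of_analyticRank_le_one)
    (hϖ : realPeriodRat_eq_unit_mul_plusPeriod)
    (hU : Silverman1994_thmV53_tateUniformisation.{0})
    (hU2 : Silverman1994_thmV53_corV54_tateUniformisation.{0})
    (hF44 : thm44_selmerLocalKer_iff_of_nonsplit_good) (hF13 : thm132_fiveCongruent_hessePencil)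
    {W F : WeierstrassCurve ℚ} [W.IsElliptic] [W.IsGloballyMinimal] [F.IsElliptic] [F.IsGloballyMinimal]
    (hWeq : W = ⟨1, 0, 0, 3140254662, -139987982322460⟩) (hFeq : F = ⟨1, 0, 0, -14128, -645920⟩)
    {N : ℕ} [NeZero N] (f : CuspForm (Gamma0 N) 2) (hf : IsNewformOf W f)
    (hball0 : ∃ mid rad : ℝ, rad ≤ 1 / 10 ^ (20 : ℕ) ∧ |mid - ((1250 : ℤ) : ℝ)| ≤ 1 / 10 ^ (20 : ℕ) ∧
      |((3 : ℕ) : ℝ) * (((1 : ℕ) : ℝ) * ((W.entireLFunction 1).re / plusPeriod f)) - mid| ≤ rad) :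
    MissingLowerBoundAt W 5 := by
  haveI : Fact (Nat.Prime 5) := ⟨by norm_num⟩
  have hIW : integralModelInt W = ⟨1, 0, 0, 3140254662, -139987982322460⟩ :=
    integralModelInt_eq_of_map_eq _ (by rw [hWeq]; ext <;> simp [WeierstrassCurve.map])
  have hX : ClassX6 W 5 :=
    classX6_of_intModel 5 le_rfl hIW (by decide +kernel) card_c22678e1_5 (by decide) (by decide +kernel)
  obtain ⟨hr0, q, hq, hv⟩ := analyticRank_shaAn_of_LOneBall_of_rowCheckZ hϖ hGZK W 5 (by norm_num) hX.1 f hf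
    _ _ 3 1 (by norm_num) 1250 (by norm_num) hball0 hIW
    (Es := [⟨2, 1, 1, 0, 0, 0, 0, 75, 0, 0, 75⟩, ⟨17, 4, 3, 0, 0, 0, 0, 1, 0, 0, 1⟩, ⟨23, 4, 3, 0, 0, 0, 0, 1, 0, 0, 1⟩, ⟨29, 5, 3, 0, 0, 0, 0, 4, 0, 0, 2⟩]) (Xs := [])
    (Zs := []) (by decide +kernel) (by decide +kernel) 2 2 (by decide +kernel) (by decide)
  have hrank : 2 ≤ F.mordellWeilRank := by rw [hFeq]; exact two_le_rank_c430882i1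
  have hc4 : W.c₄ = (-150732223775 : ℚ) := by
    subst hWeq; norm_num [WeierstrassCurve.c₄, WeierstrassCurve.b₂, WeierstrassCurve.b₄]
  have hc6 : W.c₆ = (120949842824941103 : ℚ) := by
    subst hWeq; norm_num [WeierstrassCurve.c₆, WeierstrassCurve.b₂, WeierstrassCurve.b₄, WeierstrassCurve.b₆]
  have hc4F : F.c₄ = (678145 : ℚ) := by
    subst hFeq; norm_num [WeierstrassCurve.c₄, WeierstrassCurve.b₂, WeierstrassCurve.b₄]
  have hc6F : F.c₆ = (557057663 : ℚ) := by
    subst hFeq; norm_num [WeierstrassCurve.c₆, WeierstrassCurve.b₂, WeierstrassCurve.b₄, WeierstrassCurve.b₆]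
  obtain ⟨θ, hθ⟩ := fiveCongruent_of_hesseCertificate hF13 W F (-641807 : ℚ) 1
    (207777213817353652567632204791808 : ℚ) (by norm_num)
    (by rw [hc4, hc6, hc4F, eval_hesseC4]; norm_num) (by rw [hc4, hc6, hc6F, eval_hesseC6]; norm_num)
  -- kind (iii) at 2: γ(E)/γ(F) = N/D with N·D an 2-adic square (v_2 = 0, `sqFlagAt` true) and μ_5(ℚ_2) = 1 (2 ≢ 1 mod 5) — both DECIDED
  have h2 : ∀ w : HeightOneSpectrum (𝓞 ℚ), (primesEquiv w : ℕ) = 2 →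
      (∃ r : w.adicCompletion ℚ, algebraMap ℚ (w.adicCompletion ℚ) (-(W.c₄ / W.c₆)) =
          r ^ 2 * algebraMap ℚ (w.adicCompletion ℚ) (-(F.c₄ / F.c₆))) ∧
        (∀ ζ : w.adicCompletion ℚ, ζ ^ 5 = 1 → ζ = 1) := by
    intro w hw
    haveI : Fact (Nat.Prime 2) := ⟨by norm_num⟩
    refine ⟨?_, Literature.NumberTheory.GaloisRepresentations.adicCompletion_pow_eq_one_imp w
      (natCast_not_mem_of_primesEquiv_ne w (Fact.out : Nat.Prime 5) (by rw [hw]; decide))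
      (by rw [Summit.BirchSwinnertonDyer.Rank1Residual.Additive.ZpTower.residueCard_eq_of_prime_mem (by norm_num : Nat.Prime 2)
        (Literature.NumberTheory.EllipticCurves.Rank1Residual.natCast_mem_asIdeal_of_primesEquiv_eq hw)]; decide)⟩
    rw [hc4, hc6, hc4F, hc6F]
    exact exists_eq_sq_mul_of_sqFlagAt w hw (N := -16793308062978907565) (D := 16404306232503936858787) (by norm_num) (by norm_num) (by norm_num)
      (w := 0) (by norm_num) (by norm_num) (by decide +kernel)
  -- kind (iii) at 29: γ(E)/γ(F) = N/D with N·D an 29-adic square (v_29 = 0, `sqFlagAt` true) and μ_5(ℚ_29) = 1 (29 ≢ 1 mod 5) — both DECIDED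
  have h29 : ∀ w : HeightOneSpectrum (𝓞 ℚ), (primesEquiv w : ℕ) = 29 →
      (∃ r : w.adicCompletion ℚ, algebraMap ℚ (w.adicCompletion ℚ) (-(W.c₄ / W.c₆)) =
          r ^ 2 * algebraMap ℚ (w.adicCompletion ℚ) (-(F.c₄ / F.c₆))) ∧
        (∀ ζ : w.adicCompletion ℚ, ζ ^ 5 = 1 → ζ = 1) := by
    intro w hw
    haveI : Fact (Nat.Prime 29) := ⟨by norm_num⟩
    refine ⟨?_, Literature.NumberTheory.GaloisRepresentations.adicCompletion_pow_eq_one_imp w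
      (natCast_not_mem_of_primesEquiv_ne w (Fact.out : Nat.Prime 5) (by rw [hw]; decide))
      (by rw [Summit.BirchSwinnertonDyer.Rank1Residual.Additive.ZpTower.residueCard_eq_of_prime_mem (by norm_num : Nat.Prime 29)
        (Literature.NumberTheory.EllipticCurves.Rank1Residual.natCast_mem_asIdeal_of_primesEquiv_eq hw)]; decide)⟩
    rw [hc4, hc6, hc4F, hc6F]
    exact exists_eq_sq_mul_of_sqFlagAt w hw (N := -16793308062978907565) (D := 16404306232503936858787) (by norm_num) (by norm_num) (by norm_num)
      (w := 0) (by norm_num) (by norm_num) (by decide +kernel)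
  -- natCard_ker_five_partner_22678e1_at5 (X6VisibilityLocalTorsionRecords.lean), proved in place
  have h5 :
    ∀ w : HeightOneSpectrum (𝓞 ℚ), (primesEquiv w : ℕ) = 5 →
      Nat.card (nsmulAddMonoidHom 5 : (F.baseChange (w.adicCompletion ℚ)).toAffine.Point →+ _).ker = 1 := by
    intro w hw
    haveI : Fact (Nat.Prime 5) := ⟨by norm_num⟩
    refine natCard_ker_nsmul_five_adicCompletion_eq_one_of_checkAt 5 1 0 0 (-14128) (-645920) (by decide +kernel)
      (k := 1) (cert := []) (by decide +kernel) F ?_ hw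
    rw [hFeq]; ext <;> norm_num
  -- natCard_ker_five_partner_22678e1_at17 (X6VisibilityLocalTorsionRecords.lean), proved in place
  have h17 :
    ∀ w : HeightOneSpectrum (𝓞 ℚ), (primesEquiv w : ℕ) = 17 →
      Nat.card (nsmulAddMonoidHom 5 : (F.baseChange (w.adicCompletion ℚ)).toAffine.Point →+ _).ker = 1 := by
    intro w hw
    haveI : Fact (Nat.Prime 17) := ⟨by norm_num⟩
    refine natCard_ker_nsmul_five_adicCompletion_eq_one_of_checkAt 17 1 0 0 (-14128) (-645920) (by decide +kernel)
      (k := 1) (cert := []) (by decide +kernel) F ?_ hw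
    rw [hFeq]; ext <;> norm_num
  -- natCard_ker_five_partner_22678e1_at23 (X6VisibilityLocalTorsionRecords.lean), proved in place
  have h23 :
    ∀ w : HeightOneSpectrum (𝓞 ℚ), (primesEquiv w : ℕ) = 23 →
      Nat.card (nsmulAddMonoidHom 5 : (F.baseChange (w.adicCompletion ℚ)).toAffine.Point →+ _).ker = 1 := by
    intro w hw
    haveI : Fact (Nat.Prime 23) := ⟨by norm_num⟩
    refine natCard_ker_nsmul_five_adicCompletion_eq_one_of_checkAt 23 1 0 0 (-14128) (-645920) (by decide +kernel)
      (k := 1) (cert := []) (by decide +kernel) F ?_ hw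
    rw [hFeq]; ext <;> norm_num
  exact X6RankZero.missingLowerBoundAt_x6r0vis_22678e1_5_of_congr hCT hGZK hU hU2 hF44 hWeq hFeq hr0 hq hv θ hθ hrank h5 h17
    h23 h2 h29

/-- **The hW-free T3 witness: E₅'s conclusion AT THE CELL `(22678e1, 5)` from visibility + Cassels–Tate, no Kato-side binder.**
For every rational `q` with `#Ш(E)_an = q` (and `ord_5 q ≠ 0`, unused): `ord_5 q ≤ ord_5 #Ш(E/ℚ)` — the statement of
`X6RankZero.eisensteinHalfFiveLe_cell_22678e1_at5` (p542927) with the binders `hW` (Wuthrich Prop. 21) and `hmod` REMOVED.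
[cite: CremonaMazur2000, §3] [cite: Fisher2016Visualizing7, Thm. 4.4] [cite: Fisher2012Hessian, Thm. 13.2]
[cite: SilvermanAEC2009, Thm. X.4.14] [cite: Miller2011LMS, Def. 1.1] -/
theorem X6RankZero.eisensteinHalfFiveLe_cell_22678e1_at5'
    (hCT : exists_casselsTate_pairing (K := ℚ))
    (hGZK : rank_eq_analyticRank_of_analyticRank_le_one)
    (hϖ : realPeriodRat_eq_unit_mul_plusPeriod)
    (hU : Silverman1994_thmV53_tateUniformisation.{0})
    (hU2 : Silverman1994_thmV53_corV54_tateUniformisation.{0})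
    (hF44 : thm44_selmerLocalKer_iff_of_nonsplit_good) (hF13 : thm132_fiveCongruent_hessePencil)
    {W F : WeierstrassCurve ℚ} [W.IsElliptic] [W.IsGloballyMinimal] [F.IsElliptic] [F.IsGloballyMinimal]
    (hWeq : W = ⟨1, 0, 0, 3140254662, -139987982322460⟩) (hFeq : F = ⟨1, 0, 0, -14128, -645920⟩)
    {N : ℕ} [NeZero N] (f : CuspForm (Gamma0 N) 2) (hf : IsNewformOf W f)
    (hball0 : ∃ mid rad : ℝ, rad ≤ 1 / 10 ^ (20 : ℕ) ∧ |mid - ((1250 : ℤ) : ℝ)| ≤ 1 / 10 ^ (20 : ℕ) ∧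
      |((3 : ℕ) : ℝ) * (((1 : ℕ) : ℝ) * ((W.entireLFunction 1).re / plusPeriod f)) - mid| ≤ rad) :
    ∀ q : ℚ, shaAn W = (q : ℂ) → padicValRat 5 q ≠ 0 → padicValRat 5 q ≤ (padicValNat 5 W.shaOrder : ℤ) := by
  intro q hq _
  exact padicValRat_le_of_missingLowerBoundAt W 5
    (X6RankZero.missingLowerBoundAt_cell_22678e1_at5 hCT hGZK hϖ hU hU2 hF44 hF13 hWeq hFeq f hf hball0) q hq

end Summit.BirchSwinnertonDyer.Rank1Residual.Supersingular

end
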